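import Summits.BirchSwinnertonDyer.BirchSwinnertonDyer.Theorems.KolyvaginDepthDoorDepthTableRowsOfPrint1
import Summits.BirchSwinnertonDyer.BirchSwinnertonDyer.Theorems.KolyvaginDepthDoorDepthTableRowsOfPrint2
import Summits.BirchSwinnertonDyer.BirchSwinnertonDyer.Theorems.KolyvaginDepthDoorDepthTableRowsOfPrint3
import Summits.BirchSwinnertonDyer.BirchSwinnertonDyer.Theorems.KolyvaginDepthDoorDepthTableRowsOfPrint4
import Summits.BirchSwinnertonDyer.BirchSwinnertonDyer.Theorems.KolyvaginDepthDoorDepthTableRowKitVanishing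
import HarnessLib

/-!
# Route `KolyvaginDepthDoor` — DEPTH-ZERO VANISHING ROWS of the depth table, rank-2 curves
# `389a1`, `709a1`, `718b1`, `433a1`, `446d1`, `563a1`, `571b1`, `643a1`, `655a1`:
# the class of the Heegner point `y_K` dies mod `p`, on (γ) ONLY — NO bit (crux `KolyvaginDepthSupply`,
# stmt-BirchSwinnertonDyer-21765) — part 1 of 2

Helper file (`--supports stmt-BirchSwinnertonDyer-21765 --as helper`); it closes nothing and BSD is
not proved by it.

The 18 rank-2 rows `C<label>.depthRow_<p>_neg<D>_<ℓ>_print` (g8, files `…RowsPrint1–4`) read the depth-1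
bit upward («`c_1(ℓ) ≠ 0` ⟹ `t_p = 0`, rank `= 2`»). These rows are their BIT-FREE companions one level
down, from the lower bound of `…KolyvaginDepthSupplyMinimalDepth` through the kit
`…DepthTableRowKitVanishing` (this seat): on a curve with two independent rational points the
depth-ZERO class `c_1(1)` — the image of `y_K = P(1)` in `H¹(K, E[p])` — VANISHES for ANY frame
`(Dt, β, ι)` and ANY datum of conductor `1` (`y_K ∈ pE(K) + E(K)_tors`; consistent with, but not using,
`y_K` torsion at analytic rank `≥ 2`). Together with the bit rows: on these curves the minimal depth of
a non-zero level-1 class is EXACTLY `1 = rank − 1` iff the bit holds. Inputs per row: (γ) =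
`GrossLMS1991.prop37_2_frobeniusCongruence` ONLY; every side condition (`p ∈ B(E)`, non-CM, `2 ≤ rank`,
Heegner hypothesis for `d_K`, (KN_p) from `Δ(E₀)`) is the kernel certificate already used by the bit row
of the same curve (`944e1`, off the Kodaira–Néron cell, is omitted). CONDITIONAL on (γ); per-curve; BSD
is not proved by it.
-/

set_option linter.dupNamespace false

noncomputable section

open scoped Classical NumberField

namespace Summit.BirchSwinnertonDyer.BirchSwinnertonDyer.Theorems.KolyvaginDepthDoor

open Literature.NumberTheory.EllipticCurves Literature.NumberTheory.EllipticCurves.ModularForms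
  Literature.NumberTheory.EllipticCurves.McCallum1991 WeierstrassCurve
open Summit.BirchSwinnertonDyer.BirchSwinnertonDyer.Rank2Observatory
open Summit.BirchSwinnertonDyer.BirchSwinnertonDyer.Rank1Residual

namespace C389a1

/-- **DEPTH-ZERO VANISHING ROW `389a1`, `(p, d_K) = (5, -7)` — NO bit.** For `E = 389a1` (rank `2`, two
independent points certified in the kernel), ANY imaginary quadratic `K` with `d_K = -7`, any frame
`(Dt, β, ι)` and ANY Kolyvagin–Heegner datum `d` of conductor `1`, granted the ONE Literature fact (γ) =
Gross 1991 Prop. 3.7 (2): the depth-0 class VANISHES, `d.kolyvaginClass _ 1 = 0` — the class of the Heegner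
point `y_K` dies in `H¹(K, E[5])` (depth `0 ≤ rank − 2`; `depthRowZero_vanishes_printKN_of_intModel_certificate`,
side conditions = the kernel certificates of the bit row `depthRow_5_neg7_19_print`). CONDITIONAL on (γ);
per-curve; BSD is not proved by it. [cite: Kolyvagin1991MathAnn, Thm. 2.3 and Thm. 4]
[cite: GrossLMS1991, Prop. 3.7 (2), §4 (P_1 = y_K), §10] [cite: CremonaAlgorithms1997, Table 1 (389a1)] -/
theorem depthRowZero_vanishes_5_neg7_printKN
    (h372 : GrossLMS1991.prop37_2_frobeniusCongruence)
    (K : Type) [Field K] [NumberField K] (hK : IsImaginaryQuadratic K)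
    (hD : NumberField.discr K = -7) :
    haveI := curve389a1_isGloballyMinimal;
    haveI := curve389a1_neZero_conductorNorm;
    ∀ (Dt : ModularParametrizationData Curve389a1.E (Curve389a1.E.conductorNorm ℤ)) (β : ℤ)
      (ι : K →+* ℂ) (d : KolyvaginHeegnerData Dt β ι 1),
    d.kolyvaginClass (p := 5) (by norm_num) 1 = 0 := by
  haveI := curve389a1_isGloballyMinimal
  haveI := curve389a1_neZero_conductorNorm
  intro Dt β ι d
  haveI := Fact.mk (by norm_num : Nat.Prime 5)
  exact depthRowZero_vanishes_printKN_of_intModel_certificate intModel h372 not_hasCM'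
    Curve389a1.two_le_mordellWeilRank 5 (by norm_num) hasSurjectiveModNGaloisRep_pow_5 K hK hD
    (by norm_num) (by norm_num) heegner_neg7
    (Δ₀ := 389) (by decide +kernel) (B := 11) (by decide +kernel) (by decide +kernel)
    (fun _ _ ↦ Or.inl (by norm_num)) Dt β ι d

end C389a1

namespace C709a1

/-- **DEPTH-ZERO VANISHING ROW `709a1`, `(p, d_K) = (5, -7)` — NO bit.** For `E = 709a1` (rank `2`, two
independent points certified in the kernel), ANY imaginary quadratic `K` with `d_K = -7`, any frame
`(Dt, β, ι)` and ANY Kolyvagin–Heegner datum `d` of conductor `1`, granted the ONE Literature fact (γ) =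
Gross 1991 Prop. 3.7 (2): the depth-0 class VANISHES, `d.kolyvaginClass _ 1 = 0` — the class of the Heegner
point `y_K` dies in `H¹(K, E[5])` (depth `0 ≤ rank − 2`; `depthRowZero_vanishes_printKN_of_intModel_certificate`,
side conditions = the kernel certificates of the bit row `depthRow_5_neg7_409_print`). CONDITIONAL on (γ);
per-curve; BSD is not proved by it. [cite: Kolyvagin1991MathAnn, Thm. 2.3 and Thm. 4]
[cite: GrossLMS1991, Prop. 3.7 (2), §4 (P_1 = y_K), §10] [cite: CremonaAlgorithms1997, Table 1 (709a1)] -/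
theorem depthRowZero_vanishes_5_neg7_printKN
    (h372 : GrossLMS1991.prop37_2_frobeniusCongruence)
    (K : Type) [Field K] [NumberField K] (hK : IsImaginaryQuadratic K)
    (hD : NumberField.discr K = -7) :
    haveI := isElliptic_c709a1;
    haveI := isGloballyMinimal_c709a1;
    haveI : NeZero (((⟨0, -1, 1, -2, 0⟩ : WeierstrassCurve ℤ).map (Int.castRingHom ℚ)).conductorNorm ℤ) :=
      neZero_conductorNorm_of_isElliptic _;
    ∀ (Dt : ModularParametrizationData ((⟨0, -1, 1, -2, 0⟩ : WeierstrassCurve ℤ).map (Int.castRingHom ℚ))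
        (((⟨0, -1, 1, -2, 0⟩ : WeierstrassCurve ℤ).map (Int.castRingHom ℚ)).conductorNorm ℤ)) (β : ℤ)
      (ι : K →+* ℂ) (d : KolyvaginHeegnerData Dt β ι 1),
    d.kolyvaginClass (p := 5) (by norm_num) 1 = 0 := by
  haveI := isElliptic_c709a1
  haveI := isGloballyMinimal_c709a1
  haveI : NeZero (((⟨0, -1, 1, -2, 0⟩ : WeierstrassCurve ℤ).map (Int.castRingHom ℚ)).conductorNorm ℤ) :=
    neZero_conductorNorm_of_isElliptic _
  intro Dt β ι d
  haveI := Fact.mk (by norm_num : Nat.Prime 5)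
  exact depthRowZero_vanishes_printKN_of_intModel_certificate intModel h372 not_hasCM
    KernelCerts002.C709a1.two_le_rank 5 (by norm_num) hasSurjectiveModNGaloisRep_pow_5 K hK hD
    (by norm_num) (by norm_num) heegner_neg7
    (Δ₀ := 709) (by decide +kernel) (B := 11) (by decide +kernel) (by decide +kernel)
    (fun _ _ ↦ Or.inl (by norm_num)) Dt β ι d

end C709a1

namespace C718b1

/-- **DEPTH-ZERO VANISHING ROW `718b1`, `(p, d_K) = (5, -7)` — NO bit.** For `E = 718b1` (rank `2`, two
independent points certified in the kernel), ANY imaginary quadratic `K` with `d_K = -7`, any frame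
`(Dt, β, ι)` and ANY Kolyvagin–Heegner datum `d` of conductor `1`, granted the ONE Literature fact (γ) =
Gross 1991 Prop. 3.7 (2): the depth-0 class VANISHES, `d.kolyvaginClass _ 1 = 0` — the class of the Heegner
point `y_K` dies in `H¹(K, E[5])` (depth `0 ≤ rank − 2`; `depthRowZero_vanishes_printKN_of_intModel_certificate`,
side conditions = the kernel certificates of the bit row `depthRow_5_neg7_59_print`). CONDITIONAL on (γ);
per-curve; BSD is not proved by it. [cite: Kolyvagin1991MathAnn, Thm. 2.3 and Thm. 4]
[cite: GrossLMS1991, Prop. 3.7 (2), §4 (P_1 = y_K), §10] [cite: CremonaAlgorithms1997, Table 1 (718b1)] -/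
theorem depthRowZero_vanishes_5_neg7_printKN
    (h372 : GrossLMS1991.prop37_2_frobeniusCongruence)
    (K : Type) [Field K] [NumberField K] (hK : IsImaginaryQuadratic K)
    (hD : NumberField.discr K = -7) :
    haveI := isElliptic_c718b1;
    haveI := isGloballyMinimal_c718b1;
    haveI : NeZero (((⟨1, 0, 1, -5, 0⟩ : WeierstrassCurve ℤ).map (Int.castRingHom ℚ)).conductorNorm ℤ) :=
      neZero_conductorNorm_of_isElliptic _;
    ∀ (Dt : ModularParametrizationData ((⟨1, 0, 1, -5, 0⟩ : WeierstrassCurve ℤ).map (Int.castRingHom ℚ))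
        (((⟨1, 0, 1, -5, 0⟩ : WeierstrassCurve ℤ).map (Int.castRingHom ℚ)).conductorNorm ℤ)) (β : ℤ)
      (ι : K →+* ℂ) (d : KolyvaginHeegnerData Dt β ι 1),
    d.kolyvaginClass (p := 5) (by norm_num) 1 = 0 := by
  haveI := isElliptic_c718b1
  haveI := isGloballyMinimal_c718b1
  haveI : NeZero (((⟨1, 0, 1, -5, 0⟩ : WeierstrassCurve ℤ).map (Int.castRingHom ℚ)).conductorNorm ℤ) :=
    neZero_conductorNorm_of_isElliptic _
  intro Dt β ι d
  haveI := Fact.mk (by norm_num : Nat.Prime 5)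
  exact depthRowZero_vanishes_printKN_of_intModel_certificate intModel h372 not_hasCM
    KernelCerts002.C718b1.two_le_rank 5 (by norm_num) hasSurjectiveModNGaloisRep_pow_5 K hK hD
    (by norm_num) (by norm_num) heegner_neg7
    (Δ₀ := 5744) (by decide +kernel) (B := 11) (by decide +kernel) (by decide +kernel)
    (fun _ _ ↦ Or.inl (by norm_num)) Dt β ι d

end C718b1

namespace C433a1

/-- **DEPTH-ZERO VANISHING ROW `433a1`, `(p, d_K) = (5, -8)` — NO bit.** For `E = 433a1` (rank `2`, two
independent points certified in the kernel), ANY imaginary quadratic `K` with `d_K = -8`, any frame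
`(Dt, β, ι)` and ANY Kolyvagin–Heegner datum `d` of conductor `1`, granted the ONE Literature fact (γ) =
Gross 1991 Prop. 3.7 (2): the depth-0 class VANISHES, `d.kolyvaginClass _ 1 = 0` — the class of the Heegner
point `y_K` dies in `H¹(K, E[5])` (depth `0 ≤ rank − 2`; `depthRowZero_vanishes_printKN_of_intModel_certificate`,
side conditions = the kernel certificates of the bit row `depthRow_5_neg8_79_print`). CONDITIONAL on (γ);
per-curve; BSD is not proved by it. [cite: Kolyvagin1991MathAnn, Thm. 2.3 and Thm. 4]
[cite: GrossLMS1991, Prop. 3.7 (2), §4 (P_1 = y_K), §10] [cite: CremonaAlgorithms1997, Table 1 (433a1)] -/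
theorem depthRowZero_vanishes_5_neg8_printKN
    (h372 : GrossLMS1991.prop37_2_frobeniusCongruence)
    (K : Type) [Field K] [NumberField K] (hK : IsImaginaryQuadratic K)
    (hD : NumberField.discr K = -8) :
    haveI := isElliptic_c433a1;
    haveI := isGloballyMinimal_c433a1;
    haveI : NeZero (((⟨1, 0, 0, 0, 1⟩ : WeierstrassCurve ℤ).map (Int.castRingHom ℚ)).conductorNorm ℤ) :=
      neZero_conductorNorm_of_isElliptic _;
    ∀ (Dt : ModularParametrizationData ((⟨1, 0, 0, 0, 1⟩ : WeierstrassCurve ℤ).map (Int.castRingHom ℚ))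
        (((⟨1, 0, 0, 0, 1⟩ : WeierstrassCurve ℤ).map (Int.castRingHom ℚ)).conductorNorm ℤ)) (β : ℤ)
      (ι : K →+* ℂ) (d : KolyvaginHeegnerData Dt β ι 1),
    d.kolyvaginClass (p := 5) (by norm_num) 1 = 0 := by
  haveI := isElliptic_c433a1
  haveI := isGloballyMinimal_c433a1
  haveI : NeZero (((⟨1, 0, 0, 0, 1⟩ : WeierstrassCurve ℤ).map (Int.castRingHom ℚ)).conductorNorm ℤ) :=
    neZero_conductorNorm_of_isElliptic _
  intro Dt β ι d
  haveI := Fact.mk (by norm_num : Nat.Prime 5)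
  exact depthRowZero_vanishes_printKN_of_intModel_certificate intModel h372 not_hasCM
    KernelCerts001.C433a1.two_le_rank 5 (by norm_num) hasSurjectiveModNGaloisRep_pow_5 K hK hD
    (by norm_num) (by norm_num) heegner_neg8
    (Δ₀ := -433) (by decide +kernel) (B := 11) (by decide +kernel) (by decide +kernel)
    (fun _ _ ↦ Or.inl (by norm_num)) Dt β ι d

end C433a1

namespace C446d1

/-- **DEPTH-ZERO VANISHING ROW `446d1`, `(p, d_K) = (5, -23)` — NO bit.** For `E = 446d1` (rank `2`, two
independent points certified in the kernel), ANY imaginary quadratic `K` with `d_K = -23`, any frame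
`(Dt, β, ι)` and ANY Kolyvagin–Heegner datum `d` of conductor `1`, granted the ONE Literature fact (γ) =
Gross 1991 Prop. 3.7 (2): the depth-0 class VANISHES, `d.kolyvaginClass _ 1 = 0` — the class of the Heegner
point `y_K` dies in `H¹(K, E[5])` (depth `0 ≤ rank − 2`; `depthRowZero_vanishes_printKN_of_intModel_certificate`,
side conditions = the kernel certificates of the bit row `depthRow_5_neg23_19_print`). CONDITIONAL on (γ);
per-curve; BSD is not proved by it. [cite: Kolyvagin1991MathAnn, Thm. 2.3 and Thm. 4]
[cite: GrossLMS1991, Prop. 3.7 (2), §4 (P_1 = y_K), §10] [cite: CremonaAlgorithms1997, Table 1 (446d1)] -/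
theorem depthRowZero_vanishes_5_neg23_printKN
    (h372 : GrossLMS1991.prop37_2_frobeniusCongruence)
    (K : Type) [Field K] [NumberField K] (hK : IsImaginaryQuadratic K)
    (hD : NumberField.discr K = -23) :
    haveI := isElliptic_c446d1;
    haveI := isGloballyMinimal_c446d1;
    haveI : NeZero (((⟨1, -1, 0, -4, 4⟩ : WeierstrassCurve ℤ).map (Int.castRingHom ℚ)).conductorNorm ℤ) :=
      neZero_conductorNorm_of_isElliptic _;
    ∀ (Dt : ModularParametrizationData ((⟨1, -1, 0, -4, 4⟩ : WeierstrassCurve ℤ).map (Int.castRingHom ℚ))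
        (((⟨1, -1, 0, -4, 4⟩ : WeierstrassCurve ℤ).map (Int.castRingHom ℚ)).conductorNorm ℤ)) (β : ℤ)
      (ι : K →+* ℂ) (d : KolyvaginHeegnerData Dt β ι 1),
    d.kolyvaginClass (p := 5) (by norm_num) 1 = 0 := by
  haveI := isElliptic_c446d1
  haveI := isGloballyMinimal_c446d1
  haveI : NeZero (((⟨1, -1, 0, -4, 4⟩ : WeierstrassCurve ℤ).map (Int.castRingHom ℚ)).conductorNorm ℤ) :=
    neZero_conductorNorm_of_isElliptic _
  intro Dt β ι d
  haveI := Fact.mk (by norm_num : Nat.Prime 5)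
  exact depthRowZero_vanishes_printKN_of_intModel_certificate intModel h372 not_hasCM
    KernelCerts001.C446d1.two_le_rank 5 (by norm_num) hasSurjectiveModNGaloisRep_pow_5 K hK hD
    (by norm_num) (by norm_num) heegner_neg23
    (Δ₀ := 892) (by decide +kernel) (B := 11) (by decide +kernel) (by decide +kernel)
    (fun _ _ ↦ Or.inl (by norm_num)) Dt β ι d

end C446d1

namespace C563a1

/-- **DEPTH-ZERO VANISHING ROW `563a1`, `(p, d_K) = (5, -8)` — NO bit.** For `E = 563a1` (rank `2`, two
independent points certified in the kernel), ANY imaginary quadratic `K` with `d_K = -8`, any frame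
`(Dt, β, ι)` and ANY Kolyvagin–Heegner datum `d` of conductor `1`, granted the ONE Literature fact (γ) =
Gross 1991 Prop. 3.7 (2): the depth-0 class VANISHES, `d.kolyvaginClass _ 1 = 0` — the class of the Heegner
point `y_K` dies in `H¹(K, E[5])` (depth `0 ≤ rank − 2`; `depthRowZero_vanishes_printKN_of_intModel_certificate`,
side conditions = the kernel certificates of the bit row `depthRow_5_neg8_199_print`). CONDITIONAL on (γ);
per-curve; BSD is not proved by it. [cite: Kolyvagin1991MathAnn, Thm. 2.3 and Thm. 4]
[cite: GrossLMS1991, Prop. 3.7 (2), §4 (P_1 = y_K), §10] [cite: CremonaAlgorithms1997, Table 1 (563a1)] -/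
theorem depthRowZero_vanishes_5_neg8_printKN
    (h372 : GrossLMS1991.prop37_2_frobeniusCongruence)
    (K : Type) [Field K] [NumberField K] (hK : IsImaginaryQuadratic K)
    (hD : NumberField.discr K = -8) :
    haveI := isElliptic_c563a1;
    haveI := isGloballyMinimal_c563a1;
    haveI : NeZero (((⟨1, 1, 1, -15, 16⟩ : WeierstrassCurve ℤ).map (Int.castRingHom ℚ)).conductorNorm ℤ) :=
      neZero_conductorNorm_of_isElliptic _;
    ∀ (Dt : ModularParametrizationData ((⟨1, 1, 1, -15, 16⟩ : WeierstrassCurve ℤ).map (Int.castRingHom ℚ))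
        (((⟨1, 1, 1, -15, 16⟩ : WeierstrassCurve ℤ).map (Int.castRingHom ℚ)).conductorNorm ℤ)) (β : ℤ)
      (ι : K →+* ℂ) (d : KolyvaginHeegnerData Dt β ι 1),
    d.kolyvaginClass (p := 5) (by norm_num) 1 = 0 := by
  haveI := isElliptic_c563a1
  haveI := isGloballyMinimal_c563a1
  haveI : NeZero (((⟨1, 1, 1, -15, 16⟩ : WeierstrassCurve ℤ).map (Int.castRingHom ℚ)).conductorNorm ℤ) :=
    neZero_conductorNorm_of_isElliptic _
  intro Dt β ι d
  haveI := Fact.mk (by norm_num : Nat.Prime 5)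
  exact depthRowZero_vanishes_printKN_of_intModel_certificate intModel h372 not_hasCM
    KernelCerts001.C563a1.two_le_rank 5 (by norm_num) hasSurjectiveModNGaloisRep_pow_5 K hK hD
    (by norm_num) (by norm_num) heegner_neg8
    (Δ₀ := -563) (by decide +kernel) (B := 11) (by decide +kernel) (by decide +kernel)
    (fun _ _ ↦ Or.inl (by norm_num)) Dt β ι d

end C563a1

namespace C571b1

/-- **DEPTH-ZERO VANISHING ROW `571b1`, `(p, d_K) = (5, -8)` — NO bit.** For `E = 571b1` (rank `2`, two
independent points certified in the kernel), ANY imaginary quadratic `K` with `d_K = -8`, any frame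
`(Dt, β, ι)` and ANY Kolyvagin–Heegner datum `d` of conductor `1`, granted the ONE Literature fact (γ) =
Gross 1991 Prop. 3.7 (2): the depth-0 class VANISHES, `d.kolyvaginClass _ 1 = 0` — the class of the Heegner
point `y_K` dies in `H¹(K, E[5])` (depth `0 ≤ rank − 2`; `depthRowZero_vanishes_printKN_of_intModel_certificate`,
side conditions = the kernel certificates of the bit row `depthRow_5_neg8_29_print`). CONDITIONAL on (γ);
per-curve; BSD is not proved by it. [cite: Kolyvagin1991MathAnn, Thm. 2.3 and Thm. 4]
[cite: GrossLMS1991, Prop. 3.7 (2), §4 (P_1 = y_K), §10] [cite: CremonaAlgorithms1997, Table 1 (571b1)] -/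
theorem depthRowZero_vanishes_5_neg8_printKN
    (h372 : GrossLMS1991.prop37_2_frobeniusCongruence)
    (K : Type) [Field K] [NumberField K] (hK : IsImaginaryQuadratic K)
    (hD : NumberField.discr K = -8) :
    haveI := isElliptic_c571b1;
    haveI := isGloballyMinimal_c571b1;
    haveI : NeZero (((⟨0, 1, 1, -4, 2⟩ : WeierstrassCurve ℤ).map (Int.castRingHom ℚ)).conductorNorm ℤ) :=
      neZero_conductorNorm_of_isElliptic _;
    ∀ (Dt : ModularParametrizationData ((⟨0, 1, 1, -4, 2⟩ : WeierstrassCurve ℤ).map (Int.castRingHom ℚ))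
        (((⟨0, 1, 1, -4, 2⟩ : WeierstrassCurve ℤ).map (Int.castRingHom ℚ)).conductorNorm ℤ)) (β : ℤ)
      (ι : K →+* ℂ) (d : KolyvaginHeegnerData Dt β ι 1),
    d.kolyvaginClass (p := 5) (by norm_num) 1 = 0 := by
  haveI := isElliptic_c571b1
  haveI := isGloballyMinimal_c571b1
  haveI : NeZero (((⟨0, 1, 1, -4, 2⟩ : WeierstrassCurve ℤ).map (Int.castRingHom ℚ)).conductorNorm ℤ) :=
    neZero_conductorNorm_of_isElliptic _
  intro Dt β ι d
  haveI := Fact.mk (by norm_num : Nat.Prime 5)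
  exact depthRowZero_vanishes_printKN_of_intModel_certificate intModel h372 not_hasCM
    KernelCerts001.C571b1.two_le_rank 5 (by norm_num) hasSurjectiveModNGaloisRep_pow_5 K hK hD
    (by norm_num) (by norm_num) heegner_neg8
    (Δ₀ := -571) (by decide +kernel) (B := 11) (by decide +kernel) (by decide +kernel)
    (fun _ _ ↦ Or.inl (by norm_num)) Dt β ι d

end C571b1

namespace C643a1

/-- **DEPTH-ZERO VANISHING ROW `643a1`, `(p, d_K) = (5, -8)` — NO bit.** For `E = 643a1` (rank `2`, two
independent points certified in the kernel), ANY imaginary quadratic `K` with `d_K = -8`, any frame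
`(Dt, β, ι)` and ANY Kolyvagin–Heegner datum `d` of conductor `1`, granted the ONE Literature fact (γ) =
Gross 1991 Prop. 3.7 (2): the depth-0 class VANISHES, `d.kolyvaginClass _ 1 = 0` — the class of the Heegner
point `y_K` dies in `H¹(K, E[5])` (depth `0 ≤ rank − 2`; `depthRowZero_vanishes_printKN_of_intModel_certificate`,
side conditions = the kernel certificates of the bit row `depthRow_5_neg8_149_print`). CONDITIONAL on (γ);
per-curve; BSD is not proved by it. [cite: Kolyvagin1991MathAnn, Thm. 2.3 and Thm. 4]
[cite: GrossLMS1991, Prop. 3.7 (2), §4 (P_1 = y_K), §10] [cite: CremonaAlgorithms1997, Table 1 (643a1)] -/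
theorem depthRowZero_vanishes_5_neg8_printKN
    (h372 : GrossLMS1991.prop37_2_frobeniusCongruence)
    (K : Type) [Field K] [NumberField K] (hK : IsImaginaryQuadratic K)
    (hD : NumberField.discr K = -8) :
    haveI := isElliptic_c643a1;
    haveI := isGloballyMinimal_c643a1;
    haveI : NeZero (((⟨1, 0, 0, -4, 3⟩ : WeierstrassCurve ℤ).map (Int.castRingHom ℚ)).conductorNorm ℤ) :=
      neZero_conductorNorm_of_isElliptic _;
    ∀ (Dt : ModularParametrizationData ((⟨1, 0, 0, -4, 3⟩ : WeierstrassCurve ℤ).map (Int.castRingHom ℚ))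
        (((⟨1, 0, 0, -4, 3⟩ : WeierstrassCurve ℤ).map (Int.castRingHom ℚ)).conductorNorm ℤ)) (β : ℤ)
      (ι : K →+* ℂ) (d : KolyvaginHeegnerData Dt β ι 1),
    d.kolyvaginClass (p := 5) (by norm_num) 1 = 0 := by
  haveI := isElliptic_c643a1
  haveI := isGloballyMinimal_c643a1
  haveI : NeZero (((⟨1, 0, 0, -4, 3⟩ : WeierstrassCurve ℤ).map (Int.castRingHom ℚ)).conductorNorm ℤ) :=
    neZero_conductorNorm_of_isElliptic _
  intro Dt β ι d
  haveI := Fact.mk (by norm_num : Nat.Prime 5)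
  exact depthRowZero_vanishes_printKN_of_intModel_certificate intModel h372 not_hasCM
    KernelCerts001.C643a1.two_le_rank 5 (by norm_num) hasSurjectiveModNGaloisRep_pow_5 K hK hD
    (by norm_num) (by norm_num) heegner_neg8
    (Δ₀ := -643) (by decide +kernel) (B := 11) (by decide +kernel) (by decide +kernel)
    (fun _ _ ↦ Or.inl (by norm_num)) Dt β ι d

end C643a1

namespace C655a1

/-- **DEPTH-ZERO VANISHING ROW `655a1`, `(p, d_K) = (7, -51)` — NO bit.** For `E = 655a1` (rank `2`, two
independent points certified in the kernel), ANY imaginary quadratic `K` with `d_K = -51`, any frame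
`(Dt, β, ι)` and ANY Kolyvagin–Heegner datum `d` of conductor `1`, granted the ONE Literature fact (γ) =
Gross 1991 Prop. 3.7 (2): the depth-0 class VANISHES, `d.kolyvaginClass _ 1 = 0` — the class of the Heegner
point `y_K` dies in `H¹(K, E[7])` (depth `0 ≤ rank − 2`; `depthRowZero_vanishes_printKN_of_intModel_certificate`,
side conditions = the kernel certificates of the bit row `depthRow_7_neg51_83_print`). CONDITIONAL on (γ);
per-curve; BSD is not proved by it. [cite: Kolyvagin1991MathAnn, Thm. 2.3 and Thm. 4]
[cite: GrossLMS1991, Prop. 3.7 (2), §4 (P_1 = y_K), §10] [cite: CremonaAlgorithms1997, Table 1 (655a1)] -/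
theorem depthRowZero_vanishes_7_neg51_printKN
    (h372 : GrossLMS1991.prop37_2_frobeniusCongruence)
    (K : Type) [Field K] [NumberField K] (hK : IsImaginaryQuadratic K)
    (hD : NumberField.discr K = -51) :
    haveI := isElliptic_c655a1;
    haveI := isGloballyMinimal_c655a1;
    haveI : NeZero (((⟨0, 0, 1, -13, 18⟩ : WeierstrassCurve ℤ).map (Int.castRingHom ℚ)).conductorNorm ℤ) :=
      neZero_conductorNorm_of_isElliptic _;
    ∀ (Dt : ModularParametrizationData ((⟨0, 0, 1, -13, 18⟩ : WeierstrassCurve ℤ).map (Int.castRingHom ℚ))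
        (((⟨0, 0, 1, -13, 18⟩ : WeierstrassCurve ℤ).map (Int.castRingHom ℚ)).conductorNorm ℤ)) (β : ℤ)
      (ι : K →+* ℂ) (d : KolyvaginHeegnerData Dt β ι 1),
    d.kolyvaginClass (p := 7) (by norm_num) 1 = 0 := by
  haveI := isElliptic_c655a1
  haveI := isGloballyMinimal_c655a1
  haveI : NeZero (((⟨0, 0, 1, -13, 18⟩ : WeierstrassCurve ℤ).map (Int.castRingHom ℚ)).conductorNorm ℤ) :=
    neZero_conductorNorm_of_isElliptic _
  intro Dt β ι d
  haveI := Fact.mk (by norm_num : Nat.Prime 7)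
  exact depthRowZero_vanishes_printKN_of_intModel_certificate intModel h372 not_hasCM
    KernelCerts001.C655a1.two_le_rank 7 (by norm_num) hasSurjectiveModNGaloisRep_pow_7 K hK hD
    (by norm_num) (by norm_num) heegner_neg51
    (Δ₀ := -3275) (by decide +kernel) (B := 11) (by decide +kernel) (by decide +kernel)
    (fun _ _ ↦ Or.inl (by norm_num)) Dt β ι d

end C655a1

end Summit.BirchSwinnertonDyer.BirchSwinnertonDyer.Theorems.KolyvaginDepthDoor

end
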